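import Summits.Ventures.Crystal3D.Theorems.StickyWulffConstantNoReconstructionGainExactLatticeFilm
import Literature.Barriers.AtomisticToContinuum.StickySphereClusters
import HarnessLib

/-!
# The off-lattice skeleton of a criminal: every off-lattice ball has four off-lattice partners; at least
# six off-lattice balls (line `replication-exactness`, structure of minimal counterexamples)

HONEST FRAMING. Part of the venture `Summits/Ventures/Crystal3D` (cell `crystal3d-full`), supports the
crux `NoReconstructionGain` (stmt-Ventures-19144, route `route-Ventures-StickyWulffConstant`), line
`replication-exactness` (lead wulff-p1 g17).  Structure of criminals (EXACT₀'s minimal counterexamples),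
continuing `…ExactCriminalSmall` / `…ExactLatticeFilm`:

* `four_le_card_offLattice_partners_of_criminal` — in a criminal, every OFF-LATTICE ball has at least
  FOUR off-lattice film partners: its plugs and its on-lattice film partners are lattice sites at unit
  distance from an off-lattice point, so together at most `3` (`fcc_offLattice_unitContacts_le_three`),
  while strict over-attachment demands `plug + deg ≥ 7`;
* `five_le_card_offLattice_of_criminal`, `six_le_card_offLattice_of_criminal` — hence a criminal has at
  least five, indeed at least SIX off-lattice balls (five would be pairwise in contact: no five points of
  `ℝ³` are pairwise at unit distance, `no_five_pairwise_dist_two` rescaled).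

So the off-lattice part of a criminal is a unit-distance graph of minimum degree `≥ 4` on `≥ 6` vertices
(the octahedron is the smallest such graph), carrying the on-lattice part within distance `1`
(`…ExactCoreShadow`).

WHAT THIS IS NOT: the crux; rung F-C1 not moved.
-/

noncomputable section

namespace Summit.Ventures.Crystal3D.Theorems

open Summit.Ventures.Crystal3D
open Literature.MathematicalPhysics.StatisticalMechanics (fccStacking contactDeficiency orderedContacts)
open scoped InnerProductSpace
open Finset

open scoped Classical in
/-- **Every off-lattice ball of a criminal has at least four off-lattice film partners.** -/
theorem four_le_card_offLattice_partners_of_criminal {ν : EuclideanSpace ℝ (Fin 3)} {s : ℝ}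
    {Q : Finset (EuclideanSpace ℝ (Fin 3))} (hQ : IsCriminal ν s Q) {q : EuclideanSpace ℝ (Fin 3)}
    (hq : q ∈ Q) (hqΛ : q ∉ fccStacking 1 (Real.sqrt (2 / 3))) :
    4 ≤ (Q.filter fun y => y ∉ fccStacking 1 (Real.sqrt (2 / 3)) ∧ dist q y = 1).card := by
  have h7 := seven_le_plug_add_deg_of_criminal hQ hq
  -- lattice sites at unit distance from `q`: plugs and on-lattice film partners, at most three in all
  have hfin := plugSet_finite ν s q
  set T := hfin.toFinset ∪ (Q.filter fun y => y ∈ fccStacking 1 (Real.sqrt (2 / 3)) ∧ dist q y = 1)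
    with hT
  have hT3 : T.card ≤ 3 := by
    refine fcc_offLattice_unitContacts_le_three q hqΛ T fun y hy => ?_
    rw [hT, Finset.mem_union, Set.Finite.mem_toFinset, Finset.mem_filter] at hy
    rcases hy with ⟨⟨hyΛ, -⟩, hd⟩ | ⟨-, hyΛ, hd⟩
    · exact ⟨hyΛ, hd⟩
    · exact ⟨hyΛ, hd⟩
  have hdisj : Disjoint hfin.toFinset
      (Q.filter fun y => y ∈ fccStacking 1 (Real.sqrt (2 / 3)) ∧ dist q y = 1) := by
    rw [Finset.disjoint_left]
    intro y hy hy'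
    rw [Set.Finite.mem_toFinset] at hy
    rw [Finset.mem_filter] at hy'
    have := hQ.1.2 y hy'.1 y hy.1
    rw [dist_self] at this; linarith
  have hTcard : T.card = (plugSet ν s q).ncard +
      (Q.filter fun y => y ∈ fccStacking 1 (Real.sqrt (2 / 3)) ∧ dist q y = 1).card := by
    rw [hT, Finset.card_union_of_disjoint hdisj, Set.ncard_eq_toFinset_card _ hfin]
  -- split the film partners into on- and off-lattice ones
  have hsplit : (Q.filter fun y => dist q y = 1).card =
      (Q.filter fun y => y ∈ fccStacking 1 (Real.sqrt (2 / 3)) ∧ dist q y = 1).card +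
        (Q.filter fun y => y ∉ fccStacking 1 (Real.sqrt (2 / 3)) ∧ dist q y = 1).card := by
    rw [← Finset.card_union_of_disjoint]
    · congr 1
      ext y
      simp only [Finset.mem_union, Finset.mem_filter]
      tauto
    · rw [Finset.disjoint_left]
      intro y hy hy'
      exact (Finset.mem_filter.1 hy').2.1 (Finset.mem_filter.1 hy).2.1
  omega

open scoped Classical in
/-- **A criminal has at least five off-lattice balls.** -/
theorem five_le_card_offLattice_of_criminal {ν : EuclideanSpace ℝ (Fin 3)} {s : ℝ}
    {Q : Finset (EuclideanSpace ℝ (Fin 3))} (hQ : IsCriminal ν s Q) :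
    5 ≤ (Q.filter fun y => y ∉ fccStacking 1 (Real.sqrt (2 / 3))).card := by
  obtain ⟨q, hq, hqΛ⟩ := exists_not_mem_fcc_of_criminal hQ
  have h4 := four_le_card_offLattice_partners_of_criminal hQ hq hqΛ
  have hsub : (Q.filter fun y => y ∉ fccStacking 1 (Real.sqrt (2 / 3)) ∧ dist q y = 1) ⊆
      (Q.filter fun y => y ∉ fccStacking 1 (Real.sqrt (2 / 3))).erase q := by
    intro y hy
    rw [Finset.mem_filter] at hy
    rw [Finset.mem_erase, Finset.mem_filter]
    refine ⟨?_, hy.1, hy.2.1⟩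
    rintro rfl
    rw [dist_self] at hy; norm_num at hy
  have := Finset.card_le_card hsub
  rw [Finset.card_erase_of_mem (Finset.mem_filter.2 ⟨hq, hqΛ⟩)] at this
  omega

open scoped Classical in
/-- **A criminal has at least six off-lattice balls** (five would be pairwise in contact). -/
theorem six_le_card_offLattice_of_criminal {ν : EuclideanSpace ℝ (Fin 3)} {s : ℝ}
    {Q : Finset (EuclideanSpace ℝ (Fin 3))} (hQ : IsCriminal ν s Q) :
    6 ≤ (Q.filter fun y => y ∉ fccStacking 1 (Real.sqrt (2 / 3))).card := by
  set O := Q.filter fun y => y ∉ fccStacking 1 (Real.sqrt (2 / 3)) with hO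
  have h5 : 5 ≤ O.card := five_le_card_offLattice_of_criminal hQ
  by_contra hlt
  push Not at hlt
  have hcard : O.card = 5 := by omega
  -- in `O` every ball touches every other ball
  have hall : ∀ q ∈ O, ∀ y ∈ O, q ≠ y → dist q y = 1 := by
    intro q hq y hy hne
    obtain ⟨hqQ, hqΛ⟩ := Finset.mem_filter.1 hq
    have h4 := four_le_card_offLattice_partners_of_criminal hQ hqQ hqΛ
    have hsub : (Q.filter fun y => y ∉ fccStacking 1 (Real.sqrt (2 / 3)) ∧ dist q y = 1) ⊆ O.erase q := by
      intro z hz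
      rw [Finset.mem_filter] at hz
      rw [Finset.mem_erase, hO, Finset.mem_filter]
      refine ⟨?_, hz.1, hz.2.1⟩
      rintro rfl
      rw [dist_self] at hz; norm_num at hz
    have hce : (O.erase q).card = 4 := by rw [Finset.card_erase_of_mem hq, hcard]
    have heq := Finset.eq_of_subset_of_card_le hsub (by rw [hce]; exact h4)
    have hy' : y ∈ O.erase q := Finset.mem_erase.2 ⟨hne.symm, hy⟩
    rw [← heq, Finset.mem_filter] at hy'
    exact hy'.2.2
  -- five points pairwise at distance `1`: rescale by `2` and contradict
  have e : Fin 5 ≃ O := (O.equivFin.trans (finCongr hcard)).symm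
  set p : Fin 5 → EuclideanSpace ℝ (Fin 3) := fun i => (2 : ℝ) • ((e i : O) : EuclideanSpace ℝ (Fin 3))
    with hp
  refine Literature.Barriers.AtomisticToContinuum.no_five_pairwise_dist_two p fun i j hij => ?_
  have hne : ((e i : O) : EuclideanSpace ℝ (Fin 3)) ≠ (e j : O) := by
    intro h
    exact hij (e.injective (Subtype.ext h))
  have h1 := hall _ (e i).2 _ (e j).2 hne
  rw [hp]
  dsimp only
  rw [dist_smul₀, h1]
  norm_num

end Summit.Ventures.Crystal3D.Theorems

end
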